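import Summits.BirchSwinnertonDyer.BirchSwinnertonDyer.Theorems.AdditiveKolyvaginRoadLevelSystemsDichotomyOfPoitouTate
import Summits.BirchSwinnertonDyer.BirchSwinnertonDyer.Theses.AdditiveKolyvaginRoad
import HarnessLib

/-!
# Route `AdditiveKolyvaginRoad`, crux `LevelKolyvaginSystemsAdditive` (item stmt-BirchSwinnertonDyer-21396, KS′):
# the DICH door BY NAME — `(∀ K, poitouTate_selmerStructure_duality K) → KolyvaginPrimitiveAdditive → LevelKolyvaginSystemsAdditive`
# (cell `pub/bsd-wall`, width seat `bsd-wall-akr-p2x-w5` g0; `--supports stmt-BirchSwinnertonDyer-21396`, helper; the proof of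
# lead g2's socket p624986 `levelKolyvaginSystemsAdditive_of_kolyvaginPrimitiveAdditive` re-run on `dich_of_poitouTate` —
# imports only route-independent modules and the route file itself)

WHAT.
* `levelKolyvaginSystemsAdditive_of_kolyvaginPrimitiveAdditive_of_poitouTate` — **the DICH door, by name**:
  `(∀ K, poitouTate_selmerStructure_duality K) → KolyvaginPrimitiveAdditive → LevelKolyvaginSystemsAdditive`.
* `levelKolyvaginSystemsAdditive_of_kolyvaginPrimitiveAdditive_of_dual` — the same from the route's DUAL bundle
  `PublishedDualityInputsAdditiveKoly` alone (only its Poitou–Tate conjunct is used; no PUB bundle 20137, no Cassels–Tate): the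
  crux KS′ (r8) follows from the target KPA′ (r2) modulo ONE published E-side named fact. (The lead g3's Twin door
  `…LevelKolyvaginSystemsAdditiveIffKolyvaginPrimitive` gives `PUB → DUAL → (KS′ ↔ KPA′)`; this door drops PUB on the way up.)

HONEST FRAMING: two theorems; 0 definitions, 0 named facts, 0 `sorry`; CONDITIONAL on the named
Poitou–Tate fact and on KPA′ (open at `p² ∣ N`); closes nothing. BSD is not proved by any of this; KS′ and KPA′ stay OPEN.

References: [cite: WZhang2014, Thm. 4.3, Lemma 5.3, Prop. 5.4, Thm. 7.2, §8.1, Lemma 8.2, Lemma 8.4, §9]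
[cite: MazurRubin2004, Lemma 4.1.7] [cite: MilneADT2006, Ch. I, Thm. 4.10].
-/

-- single-conjunct summit: `Summit.BirchSwinnertonDyer.BirchSwinnertonDyer.…` repeats the name by design
set_option linter.dupNamespace false

noncomputable section

open scoped Classical

namespace Summit.BirchSwinnertonDyer.BirchSwinnertonDyer.Theorems.AdditiveKoly

open WeierstrassCurve NumberField IsDedekindDomain
  Literature.NumberTheory.EllipticCurves Literature.NumberTheory.EllipticCurves.ModularForms
  Literature.NumberTheory.EllipticCurves.Rank1Residual Literature.NumberTheory.GaloisRepresentations Module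
  Literature.NumberTheory.GaloisCohomology
  Summit.BirchSwinnertonDyer.Rank1Residual.X11b.Three.Koly
  Summit.BirchSwinnertonDyer.BirchSwinnertonDyer.Theses.AdditiveKolyvaginRoad

/-- **The DICH door, BY NAME: `(∀ K, poitouTate_selmerStructure_duality K) → KolyvaginPrimitiveAdditive →
LevelKolyvaginSystemsAdditive`.** The crux KS′ (stmt-BirchSwinnertonDyer-21396) follows from the route's target KPA′
(stmt-BirchSwinnertonDyer-21400) modulo ONE published E-side named fact (Poitou–Tate for Selmer structures): the proof of lead g2's socket
`levelKolyvaginSystemsAdditive_of_kolyvaginPrimitiveAdditive` (intended family `exists_transverseLevelSpaces`, synthetic system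
`nonempty_levelKolyvaginSystemP_of_selmerDichotomy`) run on `dich_of_poitouTate`. KPA′ is OPEN at `p² ∣ N`; this closes nothing. [cite: WZhang2014, Thm. 4.3, Lemma 5.3, Prop. 5.4, Thm. 7.2, §8.1, Lemma 8.2, Lemma 8.4]
[cite: MilneADT2006, Ch. I, Thm. 4.10] -/
theorem levelKolyvaginSystemsAdditive_of_kolyvaginPrimitiveAdditive_of_poitouTate
    (hPT : ∀ (K : Type) [Field K] [NumberField K], poitouTate_selmerStructure_duality K)
    (hKPA : KolyvaginPrimitiveAdditive) : LevelKolyvaginSystemsAdditive := by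
  intro W _ _ _ p _ K _ _ Dt β ι h5 hadd hsurj hsp htwo htam hr1 hK hodd hlt hH hL hβ hcM c hc1 _
  obtain ⟨𝒮, h𝒮, hfin⟩ := exists_transverseLevelSpaces W K p ι c
  obtain ⟨hLower, hRaise, hTwo⟩ := dich_of_poitouTate hPT W p K ι c h5 hsurj hK hodd hlt hc1 𝒮 h𝒮
  exact nonempty_levelKolyvaginSystemP_of_selmerDichotomy W K p Dt β ι c hK hH hβ 𝒮 h𝒮 hfin hLower hRaise hTwo
    (hKPA W p K Dt β ι h5 hadd hsurj hsp htwo htam hr1 hK hodd hlt hH hL hβ hcM)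

/-- **The DICH door from the route's DUAL bundle alone: `PublishedDualityInputsAdditiveKoly → KolyvaginPrimitiveAdditive →
LevelKolyvaginSystemsAdditive`** (only its Poitou–Tate conjunct is used; no PUB bundle, no Cassels–Tate). With the tree's
`kolyvaginPrimitiveAdditive_of_levelSystems` ∕ `bottomRankOneAdditive_of_kolyvaginPrimitiveAdditive` (which do use PUB) the
two cruxes coincide modulo the published bundles; this direction needs DUAL's Poitou–Tate half only.
[cite: WZhang2014, Thm. 4.3, §8.1, §9] [cite: MilneADT2006, Ch. I, Thm. 4.10] -/
theorem levelKolyvaginSystemsAdditive_of_kolyvaginPrimitiveAdditive_of_dual (hDual : PublishedDualityInputsAdditiveKoly)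
    (hKPA : KolyvaginPrimitiveAdditive) : LevelKolyvaginSystemsAdditive :=
  levelKolyvaginSystemsAdditive_of_kolyvaginPrimitiveAdditive_of_poitouTate (fun K _ _ ↦ hDual.2 K) hKPA

end Summit.BirchSwinnertonDyer.BirchSwinnertonDyer.Theorems.AdditiveKoly

end
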